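import Summits.ResolutionOfSingularities.ResolutionOfSingularities.Theorems.HomologicalConductorSurfaceTerminationGenusDefs
import Summits.ResolutionOfSingularities.ResolutionOfSingularities.Theorems.HomologicalConductorSurfaceTerminationRationalDescent
import Summits.ResolutionOfSingularities.ResolutionOfSingularities.Theorems.HomologicalConductorSurfaceTerminationGenusFinite
import Summits.ResolutionOfSingularities.ResolutionOfSingularities.Theorems.HomologicalConductorSurfaceTerminationGenusNonincreasing
import Summits.ResolutionOfSingularities.ResolutionOfSingularities.Theorems.HomologicalConductorSurfaceTerminationReduction
import Summits.ResolutionOfSingularities.ResolutionOfSingularities.Theorems.HomologicalConductorSurfaceTerminationResidualCriterion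
import Summits.ResolutionOfSingularities.ResolutionOfSingularities.Theorems.HomologicalConductorNoZenoCapture
import Summits.ResolutionOfSingularities.ResolutionOfSingularities.Theorems.HomologicalConductorNoZenoStageRational
import Summits.ResolutionOfSingularities.ResolutionOfSingularities.Theorems.HomologicalConductorNoZenoIffKernel
import Literature.AlgebraicGeometry.Resolution.Lipman1969RationalSurfaceSingularities
import Mathlib.RingTheory.Length
import HarnessLib

/-!
# Kill test `SurfaceTermination` (stmt-ResolutionOfSingularities-16488): the COMPOSITION of line `genus-descent`
# as a tree theorem — six facts + the residue «initial pair of constant genus» ⇒ `SurfaceTermination` BY NAME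

Route `ResolutionOfSingularities/HomologicalConductor`.  OURS (hand leafhand-res-homologicalconduct-20, 2026-08-31);
nothing here is a statement of the manuscript under review (Hironaka 2017); AI-written, weaker than expert review.

The registered skeleton of the item (`line-genus-descent-r8`, sha c2da4ae6bde8d476, planner res-L0-w44-plan-1 g17) is
NOT in the tree (`Cruxes/SurfaceTermination/` has no workfiles), so its sorry-free composition
`SurfaceTermination_of : Sig.stub_publishedSurfaceFacts → Sig.stub_initialPairOfConstantGenus → SurfaceTermination`
existed nowhere a Theorems file could use it, and its two stubs are the bare constants `Sig.*` that no land-only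
hand can target (hands 1–19 of the cell).  This file lands that composition VERBATIM with the two `Sig.*`
statements SPELLED OUT (the six-fact conjunction; the (E)-form residue (D-s)^{p_g ≥ 1}), over the tree theorems the
skeleton already used: (R2) `Descent.stub_rationalStageTerminates`, `GenusDescent.stub_pgFinite`,
`GenusDescent.stub_pgNonincreasing`, LEMMA E via `Regimes.exists_regular_of_residually_transcendental_mem_tower`,
and the reduction `Reduction.surfaceTermination_of_primeDivisorCase_of_facts`.

* `exists_regular_of_initialPair` — (6b) LEMMA E in tower form: an initial pair at stage `m'` ends the tower.
* `false_of_constantGenus_of_initialPair` — rev 3's residual DERIVED: the spelled residue forbids an eternal positive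
  constant genus along a prime divisor.
* `exists_genusZero_stage` — genus descent (bounded, non-increasing, no eternal positive constant ⇒ a genus-0 stage).
* `primeDivisorSurfaceTermination_of_facts_of_initialPair` — six facts + spelled residue ⇒ (D-s)
  `Reduction.PrimeDivisorSurfaceTermination`.
* **`surfaceTermination_of_facts_of_initialPair`** — six facts + spelled residue ⇒ the route decl
  `Theses.HomologicalConductor.SurfaceTermination` BY NAME.  A DOOR OF RECORD: a Theorems file proving the spelled
  residue (and importing the fact discharges as they land) closes the item through this theorem, independently of
  the untreed skeleton.  Sibling door with a different residue: `CaptureDescent.surfaceTermination_of_facts_of_nonrationalCapture`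
  (p831096; capture at non-rational stages, which implies the spelled residue).

No new definitions.  Named-fact hypotheses: the six facts, explicit (CJS 2020 Thm 1.2, Lipman 1969 (1.2), (4.1),
(12.1)(i), (12.1)(ii), Görtz–Wedhorn 24.44 H²).

References: J. Lipman, Publ. Math. IHÉS 36 (1969) [`Lipman1969`]; V. Cossart, U. Jannsen, S. Saito (2020), Thm. 1.2
[`CossartJannsenSaito2020`]; U. Görtz, T. Wedhorn, AG II (2023), Thm. 24.44 [`GortzWedhorn2023`]; T. Okuma,
K.-i. Watanabe, K. Yoshida, arXiv:1407.1590 (p_g-ideals; background of the residue); O. Zariski, P. Samuel,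
*Commutative Algebra* II, Ch. VI §14 [`ZariskiSamuel1960`]; planner skeleton `line-genus-descent-r8.lean` (OURS).
-/

set_option linter.dupNamespace false

noncomputable section

namespace Summit.ResolutionOfSingularities.ResolutionOfSingularities.Theorems.SurfaceTermination.GenusDescentDoor

open Summit.ResolutionOfSingularities.ResolutionOfSingularities.Theses.HomologicalConductor
open Summit.ResolutionOfSingularities.ResolutionOfSingularities.Theorems
open Summit.ResolutionOfSingularities.ResolutionOfSingularities.Theorems.NoZeno.Birth
open Summit.ResolutionOfSingularities.ResolutionOfSingularities.Theorems.SurfaceTermination.Reduction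
open Summit.ResolutionOfSingularities.ResolutionOfSingularities.Theorems.SurfaceTermination.GenusDescent
open Literature.AlgebraicGeometry.Resolution Literature.AlgebraicGeometry.Morphisms Polynomial
open CategoryTheory AlgebraicGeometry

/-! ## LEMMA E in tower form and the derived residual -/

/-- **(6b) LEMMA E in tower form: an initial pair ends the tower.**  If `g₀, g₁ ∈ ca (tower O A m')`, `g₀ ≠ 0` has
minimal `O`-value on `ca` and `t := g₁ * g₀⁻¹` is residually transcendental over `k`, then some stage is regular:
`t ∈ chart O (tower O A m') ≤ tower O A (m' + 1)` (`NoZeno.SandwichCluster.mul_inv_mem_chart`,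
`chart_le_loc_nrm_chart`, `tower_succ`), and a stage containing a residually transcendental element is followed
by a regular one (`Regimes.exists_regular_of_residually_transcendental_mem_tower`).  Text of the skeleton's lemma
of the same name. [cite: ZariskiSamuel1960, Ch. VI §14, Thm. 31] -/
theorem exists_regular_of_initialPair (p : ℕ) (hp : p.Prime) (k K : Type) [Field k] [CharP k p] [Field K]
    [Algebra k K] (O : ValuationSubring K) (A : Subalgebra k K) (hk : ∀ c : k, algebraMap k K c ∈ O)
    (hA : A.FG) (hfr : IsFractionRing ↥A K) (hAO : A.toSubring ≤ O.toSubring) (hdim : ringKrullDim ↥A = 2)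
    (m' : ℕ) {g₀ g₁ : K} (hg₀ : g₀ ∈ ca (tower O A m')) (hg₁ : g₁ ∈ ca (tower O A m')) (hg₀0 : g₀ ≠ 0)
    (hmin : ∀ c ∈ ca (tower O A m'), c * g₀⁻¹ ∈ O)
    (hval : ∀ f : k[X], f ≠ 0 → ¬ O.valuation (aeval (g₁ * g₀⁻¹) f) < 1) :
    ∃ m : ℕ, IsRegularLocalRing ↥(tower O A m) := by
  have htr : Algebra.trdeg k K ≤ 2 := (trdeg_eq_two_of_ringKrullDim_eq_two A hA hfr hdim).le
  have hchart : g₁ * g₀⁻¹ ∈ chart O (tower O A m') :=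
    NoZeno.SandwichCluster.mul_inv_mem_chart O (tower O A m') hg₁ hg₀ hg₀0 hmin
  have hsucc : g₁ * g₀⁻¹ ∈ tower O A (m' + 1) := by
    rw [tower_succ]
    exact NoZeno.SandwichCluster.chart_le_loc_nrm_chart O (tower O A m') hchart
  exact SurfaceTermination.Regimes.exists_regular_of_residually_transcendental_mem_tower p hp k K O A hk hA hfr
    hAO htr hval (m' + 1) hsucc

/-- **Rev 3's residual, DERIVED: the (E)-form residue forbids an eternal positive constant genus along a prime
divisor.**  If every eternal positive constant genus produced an initial pair (the hypothesis `hPair` = the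
skeleton's `Sig.stub_initialPairOfConstantGenus` with the six-fact binder spelled), then along a prime divisor the
geometric genus cannot equal a fixed `g + 1 ≥ 1` from some stage on: the initial pair gives a regular stage
`T_(m'')` (`exists_regular_of_initialPair`), regular stages persist (`tower_succ_eq_self_of_isRegularLocalRing`),
so `T_(m''+m+1)` is regular, hence rational (Lipman (1.1)), hence of genus `≤ 0 ≤ g` — contradiction.
[cite: Lipman1969, Definition (1.1) (p. 199)] -/
theorem false_of_constantGenus_of_initialPair
    (hPair : (CossartJannsenSaito2020General.{0} ∧ Lipman1969_1_2.{0} ∧ Lipman1969_4_1.{0} ∧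
        Lipman1969_12_1_i.{0} ∧ Lipman1969_12_1_ii.{0} ∧ GortzWedhorn2023_24_44_H2.{0}) →
      ∀ p : ℕ, p.Prime → ∀ (k K : Type) [Field k] [CharP k p] [Field K] [Algebra k K]
      (O : ValuationSubring K) (A : Subalgebra k K) (hk : ∀ c : k, algebraMap k K c ∈ O), A.FG →
      IsFractionRing ↥A K → A.toSubring ≤ O.toSubring → ringKrullDim ↥A = 2 →
      O ≠ ⊤ → IsDiscreteValuationRing ↥O → residueTrdeg k O hk + 1 = Algebra.trdeg k K →
      ∀ g m : ℕ, (∀ m' : ℕ, m ≤ m' →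
        HasGeometricGenusLE ↥(tower O A (m' + 1)) (g + 1) ∧ ¬ HasGeometricGenusLE ↥(tower O A (m' + 1)) g) →
        ∃ (m' : ℕ) (g₀ g₁ : K), g₀ ∈ ca (tower O A m') ∧ g₁ ∈ ca (tower O A m') ∧ g₀ ≠ 0 ∧
          (∀ c ∈ ca (tower O A m'), c * g₀⁻¹ ∈ O) ∧
          ∀ f : k[X], f ≠ 0 → ¬ O.valuation (aeval (g₁ * g₀⁻¹) f) < 1)
    (hF : (CossartJannsenSaito2020General.{0} ∧ Lipman1969_1_2.{0} ∧ Lipman1969_4_1.{0} ∧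
      Lipman1969_12_1_i.{0} ∧ Lipman1969_12_1_ii.{0} ∧ GortzWedhorn2023_24_44_H2.{0}))
    (p : ℕ) (hp : p.Prime) (k K : Type) [Field k] [CharP k p] [Field K] [Algebra k K]
    (O : ValuationSubring K) (A : Subalgebra k K) (hk : ∀ c : k, algebraMap k K c ∈ O) (hA : A.FG)
    (hfr : IsFractionRing ↥A K) (hAO : A.toSubring ≤ O.toSubring) (hdim : ringKrullDim ↥A = 2)
    (hOtop : O ≠ ⊤) (hdvr : IsDiscreteValuationRing ↥O) (hres : residueTrdeg k O hk + 1 = Algebra.trdeg k K)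
    (g m : ℕ) (h : ∀ m' : ℕ, m ≤ m' →
      HasGeometricGenusLE ↥(tower O A (m' + 1)) (g + 1) ∧ ¬ HasGeometricGenusLE ↥(tower O A (m' + 1)) g) :
    False := by
  obtain ⟨m', g₀, g₁, hg₀, hg₁, hg₀0, hmin, hval⟩ :=
    hPair hF p hp k K O A hk hA hfr hAO hdim hOtop hdvr hres g m h
  obtain ⟨m'', hreg⟩ := exists_regular_of_initialPair p hp k K O A hk hA hfr hAO hdim m' hg₀ hg₁ hg₀0 hmin hval
  -- regular stages are terminal: `T_(m'' + j)` is regular for every `j`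
  have hreg' : ∀ j : ℕ, IsRegularLocalRing ↥(tower O A (m'' + j)) := by
    intro j
    induction j with
    | zero => exact hreg
    | succ j ih =>
      rw [← add_assoc, tower_succ_eq_self_of_isRegularLocalRing O A hk hfr hAO (m'' + j) ih]
      exact ih
  have hrat : HasRationalSingularity ↥(tower O A (m'' + m + 1)) := by
    haveI := hreg' (m + 1)
    exact NoZeno.SandwichCluster.hasRationalSingularity_of_isRegularLocalRing _
  exact (h (m'' + m) (Nat.le_add_left m m'')).2
    (hasGeometricGenusLE_mono (Nat.zero_le g) ((hasGeometricGenusLE_zero_iff _).mpr hrat))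

/-- **Genus descent along a sequence of stages.**  From monotonicity and «no eternal positive constant genus», a
stage of genus `≤ g` is followed by a stage of genus `0` (induction on `g`; text of the skeleton's lemma).
[this work] -/
theorem exists_genusZero_stage {k K : Type} [Field k] [Field K] [Algebra k K]
    (T : ℕ → Subalgebra k K)
    (hMono : ∀ g m : ℕ, HasGeometricGenusLE ↥(T m) g → HasGeometricGenusLE ↥(T (m + 1)) g)
    (hDrop : ∀ g m : ℕ, (∀ m' : ℕ, m ≤ m' →
      HasGeometricGenusLE ↥(T m') (g + 1) ∧ ¬ HasGeometricGenusLE ↥(T m') g) → False)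
    (g m : ℕ) (hg : HasGeometricGenusLE ↥(T m) g) : ∃ m' : ℕ, HasGeometricGenusLE ↥(T m') 0 := by
  induction g generalizing m with
  | zero => exact ⟨m, hg⟩
  | succ g ih =>
    have hpers : ∀ m' : ℕ, m ≤ m' → HasGeometricGenusLE ↥(T m') (g + 1) := by
      intro m' hmm'
      induction m', hmm' using Nat.le_induction with
      | base => exact hg
      | succ n _ ihn => exact hMono (g + 1) n ihn
    have hnot : ¬ ∀ m' : ℕ, m ≤ m' →
        HasGeometricGenusLE ↥(T m') (g + 1) ∧ ¬ HasGeometricGenusLE ↥(T m') g := fun h => hDrop g m h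
    push Not at hnot
    obtain ⟨m', hmm', hm'⟩ := hnot
    exact ih m' (hm' (hpers m' hmm'))

/-! ## The composition -/

/-- **Six facts + the (E)-form residue ⇒ (D-s) `PrimeDivisorSurfaceTermination`** (the skeleton's
`primeDivisorSurfaceTermination_of`, with stubs 2–4 supplied by their tree theorems): bound `p_g(T₁) ≤ g`
(`stub_pgFinite`), descend on `g` (`stub_pgNonincreasing`, `false_of_constantGenus_of_initialPair`,
`exists_genusZero_stage`), reach a genus-`0` = rational stage, then (R2) `Descent.stub_rationalStageTerminates`.
[cite: Lipman1969, Proposition (1.2) and Theorem (4.1) (pp. 199, 204)] -/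
theorem primeDivisorSurfaceTermination_of_facts_of_initialPair
    (hF : (CossartJannsenSaito2020General.{0} ∧ Lipman1969_1_2.{0} ∧ Lipman1969_4_1.{0} ∧
      Lipman1969_12_1_i.{0} ∧ Lipman1969_12_1_ii.{0} ∧ GortzWedhorn2023_24_44_H2.{0}))
    (hPair : (CossartJannsenSaito2020General.{0} ∧ Lipman1969_1_2.{0} ∧ Lipman1969_4_1.{0} ∧
        Lipman1969_12_1_i.{0} ∧ Lipman1969_12_1_ii.{0} ∧ GortzWedhorn2023_24_44_H2.{0}) →
      ∀ p : ℕ, p.Prime → ∀ (k K : Type) [Field k] [CharP k p] [Field K] [Algebra k K]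
      (O : ValuationSubring K) (A : Subalgebra k K) (hk : ∀ c : k, algebraMap k K c ∈ O), A.FG →
      IsFractionRing ↥A K → A.toSubring ≤ O.toSubring → ringKrullDim ↥A = 2 →
      O ≠ ⊤ → IsDiscreteValuationRing ↥O → residueTrdeg k O hk + 1 = Algebra.trdeg k K →
      ∀ g m : ℕ, (∀ m' : ℕ, m ≤ m' →
        HasGeometricGenusLE ↥(tower O A (m' + 1)) (g + 1) ∧ ¬ HasGeometricGenusLE ↥(tower O A (m' + 1)) g) →
        ∃ (m' : ℕ) (g₀ g₁ : K), g₀ ∈ ca (tower O A m') ∧ g₁ ∈ ca (tower O A m') ∧ g₀ ≠ 0 ∧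
          (∀ c ∈ ca (tower O A m'), c * g₀⁻¹ ∈ O) ∧
          ∀ f : k[X], f ≠ 0 → ¬ O.valuation (aeval (g₁ * g₀⁻¹) f) < 1) :
    PrimeDivisorSurfaceTermination := by
  intro p hp k K _ _ _ _ O A hk hA hfr hAO hdim hOtop hdvr hres
  show ∃ m : ℕ, IsRegularLocalRing ↥(tower O A m)
  obtain ⟨g, hg⟩ := stub_pgFinite hF p hp k K O A hk hA hfr hAO hdim hOtop hdvr hres 0
  obtain ⟨m₁, hm₁⟩ := exists_genusZero_stage (fun n => tower O A (n + 1))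
    (fun g m h => stub_pgNonincreasing hF p hp k K O A hk hA hfr hAO hdim hOtop hdvr hres g m h)
    (fun g m h => false_of_constantGenus_of_initialPair hPair hF p hp k K O A hk hA hfr hAO hdim hOtop hdvr
      hres g m h) g 0 hg
  exact SurfaceTermination.Descent.stub_rationalStageTerminates hF p hp k K O A hk hA hfr hAO hdim m₁
    (hasRationalSingularity_of_genusLE_zero hm₁)

/-- **THE DOOR: six facts + the (E)-form residue ⇒ `SurfaceTermination` (stmt-ResolutionOfSingularities-16488) BY
NAME** — the registered skeleton's `SurfaceTermination_of` with its two stubs spelled as hypotheses, through the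
landed reduction `Reduction.surfaceTermination_of_primeDivisorCase_of_facts`. [cite: ZariskiSamuel1960, Ch. VI §14, Thm. 31] -/
theorem surfaceTermination_of_facts_of_initialPair
    (hF : (CossartJannsenSaito2020General.{0} ∧ Lipman1969_1_2.{0} ∧ Lipman1969_4_1.{0} ∧
      Lipman1969_12_1_i.{0} ∧ Lipman1969_12_1_ii.{0} ∧ GortzWedhorn2023_24_44_H2.{0}))
    (hPair : (CossartJannsenSaito2020General.{0} ∧ Lipman1969_1_2.{0} ∧ Lipman1969_4_1.{0} ∧
        Lipman1969_12_1_i.{0} ∧ Lipman1969_12_1_ii.{0} ∧ GortzWedhorn2023_24_44_H2.{0}) →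
      ∀ p : ℕ, p.Prime → ∀ (k K : Type) [Field k] [CharP k p] [Field K] [Algebra k K]
      (O : ValuationSubring K) (A : Subalgebra k K) (hk : ∀ c : k, algebraMap k K c ∈ O), A.FG →
      IsFractionRing ↥A K → A.toSubring ≤ O.toSubring → ringKrullDim ↥A = 2 →
      O ≠ ⊤ → IsDiscreteValuationRing ↥O → residueTrdeg k O hk + 1 = Algebra.trdeg k K →
      ∀ g m : ℕ, (∀ m' : ℕ, m ≤ m' →
        HasGeometricGenusLE ↥(tower O A (m' + 1)) (g + 1) ∧ ¬ HasGeometricGenusLE ↥(tower O A (m' + 1)) g) →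
        ∃ (m' : ℕ) (g₀ g₁ : K), g₀ ∈ ca (tower O A m') ∧ g₁ ∈ ca (tower O A m') ∧ g₀ ≠ 0 ∧
          (∀ c ∈ ca (tower O A m'), c * g₀⁻¹ ∈ O) ∧
          ∀ f : k[X], f ≠ 0 → ¬ O.valuation (aeval (g₁ * g₀⁻¹) f) < 1) :
    SurfaceTermination :=
  surfaceTermination_of_primeDivisorCase_of_facts hF (primeDivisorSurfaceTermination_of_facts_of_initialPair hF hPair)

end Summit.ResolutionOfSingularities.ResolutionOfSingularities.Theorems.SurfaceTermination.GenusDescentDoor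

end
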